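import Summits.AtomisticToContinuum.FouriersLaw.Theorems.HiddenChargeMazurStaticKuboStubLasotaYorkeAux1

/-!
# `HiddenChargeMazur.StaticKubo`, line `birth`, stub `stub_lasotaYorke` — aux 6: the constants

Helper file (`--supports stmt-AtomisticToContinuum-13510`, crux decl `HiddenChargeMazur.StaticKubo`,
skeleton `Cruxes/StaticKubo/Lines/birth.lean` rev 4, stub S5 `stub_lasotaYorke` of the lead).

Real-variable bookkeeping for the assembly of the Doeblin–Fortet inequality (the constants `a₁, b₁, C_M`,
the high-energy absorption, the low-energy smallness of the cut-off pair term, the low-energy shell):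

* `sqrt_flowMoment_le` — on unit-close pairs the coupling-rate factor `√G(x,y)` is `≤ exp(a₁ + b₁ √H(x))`;
* `weight_absorb` — `exp(a + b√h) e^{2ϑγT} e^{ϑh} ≤ C_M e^{θ₁h}` (`ϑ < θ₁`);
* `high_absorb` — above the threshold, `exp(a + b√h) · C e^{θ₁h − c h^{3/4}} ≤ e^{θ₁h}/2`;
* `low_small` — for `R` beyond an explicit level, `G₄^{1/4} e^{2θ₁γT} π^{1/4} ≤ 1/2`;
* `hamiltonian_le_lowShell` — if `‖x − y‖ ≤ 1` and `H(x) < E`, both energies are `≤ e^{K_H}(1 + |E|)`.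

References: folklore. Nothing here closes the item.
-/

noncomputable section

open MeasureTheory Filter Topology Set Metric
open scoped NNReal ENNReal
open Literature.MathematicalPhysics.KineticTheory.HeatConduction Literature.MathematicalPhysics.KineticTheory
open Literature.Probability.Process OscillatorChain

namespace Summit.AtomisticToContinuum.FouriersLaw.Cruxes.StaticKubo.Birth.Stubs

variable {N : ℕ}

/-- `(exp u)^{1/4} = exp(u/4)`. [folklore] -/
theorem exp_rpow_quarter (u : ℝ) : Real.exp u ^ (1 / 4 : ℝ) = Real.exp (u / 4) := by
  rw [← Real.exp_mul]; ring_nf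

section Energy

variable {ω₂ lam β : ℝ} (hω : 0 < ω₂) (hl : 0 ≤ lam) (hβ : 0 ≤ β) (γ : ℝ)
include hω hl hβ

/-- **The coupling-rate factor on unit-close pairs**: with `K_H` the energy constant of aux 1,
`√(exp(2C₀ + (8C₀²T + γ') + (4C₀²T + 1/(4T))(√Hx + √Hy))) ≤ exp(a₁ + b₁ √Hx)` for `‖x − y‖ ≤ 1`,
`a₁ = C₀ + (8C₀²T+γ')/2 + (2C₀²T + 1/(8T)) e^{K_H/2}`, `b₁ = (2C₀²T + 1/(8T))(1 + e^{K_H/2})`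
(`√Hy ≤ e^{K_H/2}(1 + √Hx)`). [folklore] -/
theorem sqrt_flowMoment_le (N : ℕ) {C₀ T : ℝ} (hT : 0 < T) (γ' : ℝ) (x y : PhaseSpace N)
    (hxy : ‖x - y‖ ≤ 1) :
    Real.sqrt (Real.exp (2 * C₀ + (8 * C₀ ^ 2 * T + γ') + (4 * C₀ ^ 2 * T + 1 / (4 * T)) *
        (Real.sqrt ((pinnedChain ω₂ lam β γ).hamiltonian N x) + Real.sqrt ((pinnedChain ω₂ lam β γ).hamiltonian N y)))) ≤
      Real.exp ((C₀ + (8 * C₀ ^ 2 * T + γ') / 2 + (2 * C₀ ^ 2 * T + 1 / (8 * T)) *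
          Real.exp ((N * (ω₂ / 2 + 3 + lam / ω₂ + N ^ 2 * (3 + β)) + N / 2 + 1) / 2)) +
        (2 * C₀ ^ 2 * T + 1 / (8 * T)) * (1 + Real.exp ((N * (ω₂ / 2 + 3 + lam / ω₂ + N ^ 2 * (3 + β)) + N / 2 + 1) / 2)) *
          Real.sqrt ((pinnedChain ω₂ lam β γ).hamiltonian N x)) := by
  set K : ℝ := N * (ω₂ / 2 + 3 + lam / ω₂ + N ^ 2 * (3 + β)) + N / 2 + 1 with hK
  have hy := sqrt_hamiltonian_le_of_norm_sub_le_one hω hl hβ γ N x y hxy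
  have hsqrt_exp : ∀ u : ℝ, Real.sqrt (Real.exp u) = Real.exp (u / 2) := fun u => by
    rw [Real.sqrt_eq_iff_mul_self_eq_of_pos (Real.exp_pos _), ← Real.exp_add]; ring_nf
  rw [hsqrt_exp]
  refine Real.exp_le_exp.2 ?_
  have hc : 0 ≤ 2 * C₀ ^ 2 * T + 1 / (8 * T) := by positivity
  have hsx : 0 ≤ Real.sqrt ((pinnedChain ω₂ lam β γ).hamiltonian N x) := Real.sqrt_nonneg _
  have h1 : (4 * C₀ ^ 2 * T + 1 / (4 * T)) / 2 = 2 * C₀ ^ 2 * T + 1 / (8 * T) := by ring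
  have key : (2 * C₀ ^ 2 * T + 1 / (8 * T)) * Real.sqrt ((pinnedChain ω₂ lam β γ).hamiltonian N y) ≤
      (2 * C₀ ^ 2 * T + 1 / (8 * T)) * (Real.exp (K / 2) * (1 + Real.sqrt ((pinnedChain ω₂ lam β γ).hamiltonian N x))) :=
    mul_le_mul_of_nonneg_left hy hc
  have : (2 * C₀ + (8 * C₀ ^ 2 * T + γ') + (4 * C₀ ^ 2 * T + 1 / (4 * T)) *
      (Real.sqrt ((pinnedChain ω₂ lam β γ).hamiltonian N x) + Real.sqrt ((pinnedChain ω₂ lam β γ).hamiltonian N y))) / 2 =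
      C₀ + (8 * C₀ ^ 2 * T + γ') / 2 + (2 * C₀ ^ 2 * T + 1 / (8 * T)) * Real.sqrt ((pinnedChain ω₂ lam β γ).hamiltonian N x) +
        (2 * C₀ ^ 2 * T + 1 / (8 * T)) * Real.sqrt ((pinnedChain ω₂ lam β γ).hamiltonian N y) := by ring
  rw [this]
  nlinarith [key]

/-- **The low-energy shell**: if `‖x − y‖ ≤ 1` and `H(x) < E`, then `H(x), H(y) ≤ e^{K_H}(1 + |E|)`. [folklore] -/
theorem hamiltonian_le_lowShell (N : ℕ) {E : ℝ} (x y : PhaseSpace N) (hxy : ‖x - y‖ ≤ 1)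
    (hx : (pinnedChain ω₂ lam β γ).hamiltonian N x < E) :
    (pinnedChain ω₂ lam β γ).hamiltonian N x ≤ Real.exp (N * (ω₂ / 2 + 3 + lam / ω₂ + N ^ 2 * (3 + β)) + N / 2 + 1) * (1 + |E|) ∧
    (pinnedChain ω₂ lam β γ).hamiltonian N y ≤ Real.exp (N * (ω₂ / 2 + 3 + lam / ω₂ + N ^ 2 * (3 + β)) + N / 2 + 1) * (1 + |E|) := by
  set K : ℝ := N * (ω₂ / 2 + 3 + lam / ω₂ + N ^ 2 * (3 + β)) + N / 2 + 1 with hK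
  have hK0 : 0 ≤ K := by
    have : 0 ≤ lam / ω₂ := div_nonneg hl hω.le
    positivity
  have h1 : (1 : ℝ) ≤ Real.exp K := Real.one_le_exp hK0
  have hE : E ≤ |E| := le_abs_self E
  have hHx : 0 ≤ (pinnedChain ω₂ lam β γ).hamiltonian N x := pinnedChain_hamiltonian_nonneg hω.le hl hβ γ N x
  have hy := hamiltonian_le_of_norm_sub_le_one hω hl hβ γ N x y hxy
  constructor
  · nlinarith [abs_nonneg E]
  · have : Real.exp K * (1 + (pinnedChain ω₂ lam β γ).hamiltonian N x) ≤ Real.exp K * (1 + |E|) := by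
      gcongr; linarith
    linarith

end Energy

/-- **Absorbing the coupling-rate factor into the weight**: for `ϑ < θ₁` and `h ≥ 0`,
`exp(a + b√h) (e^{2ϑγT} e^{ϑh}) ≤ exp(a + 2ϑγT + b²/(4(θ₁ − ϑ))) e^{θ₁h}`. [folklore] -/
theorem weight_absorb (a b ϑ θ₁ γ T h : ℝ) (hϑθ : ϑ < θ₁) (hh : 0 ≤ h) :
    Real.exp (a + b * Real.sqrt h) * (Real.exp (2 * ϑ * γ * T) * Real.exp (ϑ * h)) ≤
      Real.exp (a + 2 * ϑ * γ * T + b ^ 2 / (4 * (θ₁ - ϑ))) * Real.exp (θ₁ * h) := by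
  have hε : 0 < θ₁ - ϑ := sub_pos.2 hϑθ
  have h1 := exp_add_mul_sqrt_le (a := a) (b := b) hh hε
  calc Real.exp (a + b * Real.sqrt h) * (Real.exp (2 * ϑ * γ * T) * Real.exp (ϑ * h))
      ≤ (Real.exp (a + b ^ 2 / (4 * (θ₁ - ϑ))) * Real.exp ((θ₁ - ϑ) * h)) * (Real.exp (2 * ϑ * γ * T) * Real.exp (ϑ * h)) :=
        mul_le_mul_of_nonneg_right h1 (by positivity)
    _ = Real.exp (a + 2 * ϑ * γ * T + b ^ 2 / (4 * (θ₁ - ϑ))) * Real.exp (θ₁ * h) := by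
        rw [← Real.exp_add, ← Real.exp_add, ← Real.exp_add, ← Real.exp_add]; congr 1; ring

/-- **High-energy absorption of the pair term**: if `C exp(a + b√h − c h^{3/4}) ≤ 1/2` and `C ≥ 0`, then
`exp(a + b√h) (C exp(θ₁h − c h^{3/4})) ≤ exp(θ₁h)/2`. [folklore] -/
theorem high_absorb (a b C c θ₁ h : ℝ) (hth : C * Real.exp (a + b * Real.sqrt h - c * h ^ (3 / 4 : ℝ)) ≤ 1 / 2) :
    Real.exp (a + b * Real.sqrt h) * (C * Real.exp (θ₁ * h - c * h ^ (3 / 4 : ℝ))) ≤ Real.exp (θ₁ * h) / 2 := by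
  have heq : Real.exp (a + b * Real.sqrt h) * (C * Real.exp (θ₁ * h - c * h ^ (3 / 4 : ℝ))) =
      (C * Real.exp (a + b * Real.sqrt h - c * h ^ (3 / 4 : ℝ))) * Real.exp (θ₁ * h) := by
    have : Real.exp (a + b * Real.sqrt h) * Real.exp (θ₁ * h - c * h ^ (3 / 4 : ℝ)) =
        Real.exp (a + b * Real.sqrt h - c * h ^ (3 / 4 : ℝ)) * Real.exp (θ₁ * h) := by
      rw [← Real.exp_add, ← Real.exp_add]; congr 1; ring
    calc Real.exp (a + b * Real.sqrt h) * (C * Real.exp (θ₁ * h - c * h ^ (3 / 4 : ℝ)))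
        = C * (Real.exp (a + b * Real.sqrt h) * Real.exp (θ₁ * h - c * h ^ (3 / 4 : ℝ))) := by ring
      _ = _ := by rw [this]; ring
  rw [heq]
  have h0 : 0 < Real.exp (θ₁ * h) := Real.exp_pos _
  nlinarith

/-- **Low-energy smallness of the cut-off pair term**: with `θ₁ > 0`, `γ, T ≥ 0`, `u₄ ≤ U`, `H(x) ≤ E_L` and
`R ≥ E_L + 2γT + (4/θ₁)(U/4 + log 2 + 2θ₁γT)`,
`(exp u₄)^{1/4} · e^{2θ₁γT} · (e^{-θ₁R} e^{θ₁γ(T+T)} e^{θ₁H(x)})^{1/4} ≤ 1/2`. [folklore] -/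
theorem low_small (θ₁ γ T u₄ U EL hx R : ℝ) (hθ : 0 < θ₁) (hu : u₄ ≤ U) (hhx : hx ≤ EL)
    (hR : EL + 2 * γ * T + 4 / θ₁ * (U / 4 + Real.log 2 + 2 * θ₁ * γ * T) ≤ R) :
    Real.exp u₄ ^ (1 / 4 : ℝ) * (Real.exp (2 * θ₁ * γ * T) *
      (Real.exp (-(θ₁ * R)) * (Real.exp (θ₁ * γ * (T + T) * ((1 : ℝ≥0) : ℝ)) * Real.exp (θ₁ * hx))) ^ (1 / 4 : ℝ)) ≤ 1 / 2 := by
  rw [NNReal.coe_one, mul_one, ← Real.exp_add, ← Real.exp_add, exp_rpow_quarter, exp_rpow_quarter, ← Real.exp_add,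
    ← Real.exp_add]
  have hlog : Real.exp (-Real.log 2) = 1 / 2 := by
    rw [Real.exp_neg, Real.exp_log two_pos, one_div]
  rw [← hlog]
  refine Real.exp_le_exp.2 ?_
  -- `θ₁ R / 4 ≥ θ₁ E_L/4 + θ₁γT/2 + U/4 + log 2 + 2θ₁γT`
  have h1 : θ₁ * (EL + 2 * γ * T + 4 / θ₁ * (U / 4 + Real.log 2 + 2 * θ₁ * γ * T)) ≤ θ₁ * R :=
    mul_le_mul_of_nonneg_left hR hθ.le
  have h2 : θ₁ * (EL + 2 * γ * T + 4 / θ₁ * (U / 4 + Real.log 2 + 2 * θ₁ * γ * T)) =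
      θ₁ * EL + 2 * θ₁ * γ * T + 4 * (U / 4 + Real.log 2 + 2 * θ₁ * γ * T) := by
    field_simp
  have h3 : θ₁ * hx ≤ θ₁ * EL := mul_le_mul_of_nonneg_left hhx hθ.le
  nlinarith [h1, h2, h3, hu]

/-- **Registered form of this file's principal inequality** (`stub_lasotaYorke_aux6`, closed statement of
`weight_absorb`). [folklore] -/
theorem stub_lasotaYorke_aux6 :
    ∀ (a b ϑ θ₁ γ T h : ℝ), ϑ < θ₁ → 0 ≤ h →
      Real.exp (a + b * Real.sqrt h) * (Real.exp (2 * ϑ * γ * T) * Real.exp (ϑ * h)) ≤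
        Real.exp (a + 2 * ϑ * γ * T + b ^ 2 / (4 * (θ₁ - ϑ))) * Real.exp (θ₁ * h) :=
  weight_absorb

end Summit.AtomisticToContinuum.FouriersLaw.Cruxes.StaticKubo.Birth.Stubs

end
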